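import Summits.NavierStokesRegularity.FunctionalMining.StretchingWrapIdentity
import HarnessLib

/-!
# FunctionalMining — K1-Q1: the wrap-node blueprint, assembly A1 (`ConfinementLemma → PlanarFillerFamilyPot± → PlateauEnvelope → Confined±`)

NS FUNCTIONAL MINING cell (`pub-nsfunc`), dictionary seat gen 7 (typed), filed by the prove seat; second half of the
dictionary seat's staged `StretchingWrapIdentity.lean` (aa8d81227c82dab4), split at the 400-line cap — **search for
candidate a priori estimates; no regularity claim.** STATIC field inequalities only: nothing about Navier–Stokes
solutions is asserted anywhere in this file. Source: bank seat gen 4, `pub-nsfunc-bank/WRAP-KERNEL-BLUEPRINT.md` §7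
[ours, internal, UNREVIEWED beyond the cell]. Content: the bookkeeping lemma `confined_stats_of_bounds`, the assemblies
`confinedPlus_of_confinement` / `confinedMinus_of_confinement` (A1), and the end-to-end conditionals
`nestedLowerBound_of_blueprint`, `stretchingSupConstOn_isTwoHalfD_lt_of_blueprint` (nodes N1 + N2 + N3± + N4 ⇒
`(2+√5)/8 ≤ C⋆` and `C_{2.5D} < C⋆`). Every node is an UNPROVED `@[conjecture]` of part 1; nothing here is unconditional.
-/

noncomputable section

open Set Filter Topology MeasureTheory

namespace Summit.NavierStokesRegularity.FunctionalMining

open Literature.Analysis Literature.Analysis.FunctionSpaces Literature.Analysis.FunctionSpaces.Torus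
open Literature.Analysis.FluidPDE

/-! ## 5. Assembly A1 (bank blueprint §7): `ConfinementLemma → PlanarFillerFamilyPot± → PlateauEnvelope → Confined±` -/

/-- ε-bookkeeping shared by both signs: from filler statistics at tolerance `ε₁ = ε/2`, an envelope with
`(1/2−6δ)² ≤ ∫E³ ≤ ∫E² ≤ (1/2−4δ)²`, `0 < δ ≤ ε/24`, and confinement error `ε′ = ε/8`, the confined statistics
are within `ε` of `1/16, 1/8, 1/16`. [ours; elementary] -/
theorem confined_stats_of_bounds {ε δ π e g I2 I3 σ E T ε' : ℝ} (hε : 0 < ε) (hε1 : ε ≤ 1 / 4)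
    (hδ : 0 < δ) (hδε : δ ≤ ε / 24)
    (hπ : 1 / 4 - ε / 2 ≤ π) (he : e ≤ 1 / 2 + ε / 2) (hg : 1 / 4 - ε / 2 ≤ g)
    (hI3 : (1 / 2 - 6 * δ) ^ 2 ≤ I3) (hI32 : I3 ≤ I2) (hI2 : I2 ≤ (1 / 2 - 4 * δ) ^ 2)
    (hε' : ε' = ε / 8)
    (hσ : |σ - π * I3| ≤ ε') (hE : |E - e * I2| ≤ ε') (hT : |T - g * I2| ≤ 2 * ε') :
    1 / 16 - ε ≤ σ ∧ E ≤ 1 / 8 + ε ∧ 1 / 16 - ε ≤ T := by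
  subst hε'
  have hI3' : 1 / 4 - 6 * δ ≤ I3 := by nlinarith
  have hI2' : I2 ≤ 1 / 4 := by nlinarith
  have hI20 : 1 / 4 - 6 * δ ≤ I2 := hI3'.trans hI32
  have hπ0 : 0 ≤ 1 / 4 - ε / 2 := by linarith
  have h1 := (abs_le.1 hσ).1
  have h2 := (abs_le.1 hE).2
  have h3 := (abs_le.1 hT).1
  refine ⟨?_, ?_, ?_⟩
  · -- σ ≥ π I3 − ε/8 ≥ (1/4 − ε/2)(1/4 − 6δ) − ε/8
    have : (1 / 4 - ε / 2) * (1 / 4 - 6 * δ) ≤ π * I3 := by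
      have hI30 : 0 ≤ I3 := by nlinarith
      calc (1 / 4 - ε / 2) * (1 / 4 - 6 * δ) ≤ (1 / 4 - ε / 2) * I3 :=
            mul_le_mul_of_nonneg_left hI3' hπ0
        _ ≤ π * I3 := mul_le_mul_of_nonneg_right hπ hI30
    nlinarith
  · have : e * I2 ≤ (1 / 2 + ε / 2) * (1 / 4) := by
      have hI2n : 0 ≤ I2 := by nlinarith
      calc e * I2 ≤ (1 / 2 + ε / 2) * I2 := mul_le_mul_of_nonneg_right he hI2n
        _ ≤ (1 / 2 + ε / 2) * (1 / 4) := mul_le_mul_of_nonneg_left hI2' (by linarith)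
    nlinarith
  · have : (1 / 4 - ε / 2) * (1 / 4 - 6 * δ) ≤ g * I2 := by
      have hI2n : 0 ≤ I2 := by nlinarith
      calc (1 / 4 - ε / 2) * (1 / 4 - 6 * δ) ≤ (1 / 4 - ε / 2) * I2 :=
            mul_le_mul_of_nonneg_left hI20 hπ0
        _ ≤ g * I2 := mul_le_mul_of_nonneg_right hg hI2n
    nlinarith

/-- **A1+ : `ConfinementLemma → PlanarFillerFamilyPotPlus → PlateauEnvelope → ConfinedPlus`.** [ours] -/
theorem confinedPlus_of_confinement (hN2 : ConfinementLemma) (hN3 : PlanarFillerFamilyPotPlus)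
    (hN4 : PlateauEnvelope) : ConfinedPlus := by
  intro ε₀ hε₀
  -- work at ε := min ε₀ (1/4)
  set ε := min ε₀ (1 / 4) with hεdef
  have hε : 0 < ε := lt_min hε₀ (by norm_num)
  have hε1 : ε ≤ 1 / 4 := min_le_right _ _
  have hεε₀ : ε ≤ ε₀ := min_le_left _ _
  obtain ⟨A, hA, hAω, hπ, he, hg⟩ := hN3 (ε / 2) (by positivity)
  set δ := min (ε / 24) (1 / 32) with hδdef
  have hδ : 0 < δ := lt_min (by positivity) (by norm_num)
  have hδε : δ ≤ ε / 24 := min_le_left _ _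
  have hδ' : δ < 1 / 16 := (min_le_right _ _).trans_lt (by norm_num)
  obtain ⟨⟨E, hEs, hE01, hE0, hI3, hI32, hI2⟩, -⟩ := hN4 δ hδ hδ'
  obtain ⟨u, hu, hud, husupp, huω, huE, huσ, huT1, huT2⟩ :=
    hN2 A hA hAω E hEs hE01 (ε / 8) (by positivity)
  refine ⟨δ, hδ, hδ', u, hu, hud, ?_, huω, ?_⟩
  · -- support: `u ≡ 0` on the open set `(boxPlus 2δ)ᶜ`, where `E ≡ 0`
    intro x hx
    exact husupp (boxPlus (2 * δ))ᶜ (isClosed_boxPlus _).isOpen_compl (fun y hy => hE0 y hy) x hx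
  · have hT : |(vorticityMoment u 1 1 - vorticityMoment u 2 2) -
        (vorticityMoment (curlField A) 1 1 - vorticityMoment (curlField A) 2 2) * ∫ x, E x ^ 2| ≤
        2 * (ε / 8) := by
      have := abs_sub (vorticityMoment u 1 1 - vorticityMoment (curlField A) 1 1 * ∫ x, E x ^ 2)
        (vorticityMoment u 2 2 - vorticityMoment (curlField A) 2 2 * ∫ x, E x ^ 2)
      calc _ = |(vorticityMoment u 1 1 - vorticityMoment (curlField A) 1 1 * ∫ x, E x ^ 2) -
            (vorticityMoment u 2 2 - vorticityMoment (curlField A) 2 2 * ∫ x, E x ^ 2)| := by ring_nf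
        _ ≤ _ := this
        _ ≤ 2 * (ε / 8) := by linarith
    obtain ⟨h1, h2, h3⟩ := confined_stats_of_bounds hε hε1 hδ hδε hπ he hg hI3 hI32 hI2 rfl huσ huE hT
    exact ⟨by linarith, by linarith, by linarith⟩

/-- **A1− : `ConfinementLemma → PlanarFillerFamilyPotMinus → PlateauEnvelope → ConfinedMinus`.** [ours] -/
theorem confinedMinus_of_confinement (hN2 : ConfinementLemma) (hN3 : PlanarFillerFamilyPotMinus)
    (hN4 : PlateauEnvelope) : ConfinedMinus := by
  intro ε₀ hε₀
  set ε := min ε₀ (1 / 4) with hεdef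
  have hε : 0 < ε := lt_min hε₀ (by norm_num)
  have hε1 : ε ≤ 1 / 4 := min_le_right _ _
  have hεε₀ : ε ≤ ε₀ := min_le_left _ _
  obtain ⟨A, hA, hAω, hπ, he, hg⟩ := hN3 (ε / 2) (by positivity)
  set δ := min (ε / 24) (1 / 32) with hδdef
  have hδ : 0 < δ := lt_min (by positivity) (by norm_num)
  have hδε : δ ≤ ε / 24 := min_le_left _ _
  have hδ' : δ < 1 / 16 := (min_le_right _ _).trans_lt (by norm_num)
  obtain ⟨-, ⟨E, hEs, hE01, hE0, hI3, hI32, hI2⟩⟩ := hN4 δ hδ hδ'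
  obtain ⟨u, hu, hud, husupp, huω, huE, huσ, huT1, huT2⟩ :=
    hN2 A hA hAω E hEs hE01 (ε / 8) (by positivity)
  refine ⟨δ, hδ, hδ', u, hu, hud, ?_, huω, ?_⟩
  · intro x hx
    exact husupp (boxMinus (2 * δ))ᶜ (isClosed_boxMinus _).isOpen_compl (fun y hy => hE0 y hy) x hx
  · have hT : |(vorticityMoment u 2 2 - vorticityMoment u 1 1) -
        (vorticityMoment (curlField A) 2 2 - vorticityMoment (curlField A) 1 1) * ∫ x, E x ^ 2| ≤
        2 * (ε / 8) := by
      have := abs_sub (vorticityMoment u 2 2 - vorticityMoment (curlField A) 2 2 * ∫ x, E x ^ 2)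
        (vorticityMoment u 1 1 - vorticityMoment (curlField A) 1 1 * ∫ x, E x ^ 2)
      calc _ = |(vorticityMoment u 2 2 - vorticityMoment (curlField A) 2 2 * ∫ x, E x ^ 2) -
            (vorticityMoment u 1 1 - vorticityMoment (curlField A) 1 1 * ∫ x, E x ^ 2)| := by ring_nf
        _ ≤ _ := this
        _ ≤ 2 * (ε / 8) := by linarith
    obtain ⟨h1, h2, h3⟩ := confined_stats_of_bounds hε hε1 hδ hδε hπ he hg hI3 hI32 hI2 rfl huσ huE hT
    exact ⟨by linarith, by linarith, by linarith⟩

/-- **Full conditional chain of the blueprint (A1 + A3): N1 ∧ N2 ∧ N3± ∧ N4 ⇒ `(2+√5)/8 ≤ C⋆`.** [ours] -/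
theorem nestedLowerBound_of_blueprint (hN1 : WrapIdentityBound) (hN2 : ConfinementLemma)
    (hN3p : PlanarFillerFamilyPotPlus) (hN3m : PlanarFillerFamilyPotMinus) (hN4 : PlateauEnvelope) :
    NestedLowerBound :=
  nestedLowerBound_of_wrapIdentity hN1 (confinedPlus_of_confinement hN2 hN3p hN4)
    (confinedMinus_of_confinement hN2 hN3m hN4)

/-- **Minimal conditional chain (A1+ + A2): N1 ∧ N2 ∧ N3+ ∧ N4 ⇒ `C_{2.5D} < C⋆`.** [ours] -/
theorem stretchingSupConstOn_isTwoHalfD_lt_of_blueprint (hN1 : WrapIdentityBound)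
    (hN2 : ConfinementLemma) (hN3p : PlanarFillerFamilyPotPlus) (hN4 : PlateauEnvelope) :
    stretchingSupConstOn (IsTwoHalfD (d := Fin 3)) < stretchingSupConst (d := Fin 3) :=
  stretchingSupConstOn_isTwoHalfD_lt_of_oneSided hN1 (confinedPlus_of_confinement hN2 hN3p hN4)

end Summit.NavierStokesRegularity.FunctionalMining

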